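import Summits.CriticalPhenomena.PercolationContinuityZ3.Theorems.PercNearOneGluingNoHeavyLowerTailSahiE3OrPairPatternFlows
import Literature.Probability.LatticeModels.StrassenHolleyCoupling
import Mathlib.Data.Fintype.Pi
import Mathlib.Data.Fin.VecNotation
import Mathlib.Tactic.Linarith
import Mathlib.Tactic.FinCases
import HarnessLib
import HarnessLib.Audit

/-!
# `NoHeavyLowerTail` (crux stmt-CriticalPhenomena-4575), Sahi programme P4 (Holley / monotone coupling):
# the `1+23` slot certificate on the pattern `2³` — combinatorial interface 5: the flow certificate from 68 real inequalities

Support file (cell `prim-l12`, seat P4, generation 10; `--supports stmt-CriticalPhenomena-4575`).  No named facts, no sorries;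
standard axioms; def-free; no notation (the slot set is passed as `(M, hM : M = {100, 110, 101, 011, 111})`).  Notation and context as in `…SahiE3OrPairPatternRows`.

`…SahiE3PatternCertificate.latticeE3_nonneg_of_patternCertificate` reduces Sahi's `C₃` for the slot `↑j₀ ∪ ↑(j₁ ⊔ j₂)`
(every finite distributive lattice, every FKG weight) to a FLOW CERTIFICATE `(R, Fl)` for `(OP, ν)`, `ν` the pattern measure.
`certificate_of_ineqs` turns that into FINITELY MANY REAL INEQUALITIES, homogeneous of degree three in the eight masses and the
total mass `Z`: nonnegativity of `r`, caps `r_t ≤ Z(Z+d)n_t`, the three Hall inequalities, `Σ r = Z²u`, up-transport of the nine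
nonempty proper traces, and the 45 pair inequalities `need(S,S') ≤ r(S∩S'∩OP)` for the saturated up-sets — the canonical 68-item
list displayed in the statement (flows by `dominance` + Strassen, pairs by `pair_all`).  The existence of `r0, …, rT` satisfying the
list for every log-supermodular `ν` is `…SahiE3OrPairCert.exists_cert` (Fourier–Motzkin replay over machine-certified real algebra,
`…SahiE3OrPairAlg*`, `…SahiE3OrPairCore*`); the lattice theorem is `…SahiE3OrPairSlot`.
-/

namespace Summit.CriticalPhenomena.PercolationContinuityZ3.Theorems.SahiE3OrPairPattern

open Finset
open scoped BigOperators

/-- **The combinatorial interface.**  For a log-supermodular weight `ν ≥ 0` on `2³` with masses `nE, …, nT` (total mass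
`Z = nE + ⋯ + nT`, not normalised) and reals `r0, r01, r02, r12, rT` satisfying the canonical 68-item list (homogeneous of degree 3),
there is a flow certificate `(R, Fl)` for `(OP, ν)` in the exact format of `…SahiE3PatternCertificate.latticeE3_nonneg_of_patternCertificate`.
[this work] -/
theorem certificate_of_ineqs (M : Finset (Fin 3 → Bool))
    (hM : M = {![true, false, false], ![true, true, false], ![true, false, true], ![false, true, true], ![true, true,
        true]}) (ν : (Fin 3 → Bool) → ℝ) (hν0 : ∀ t, 0 ≤ ν t) (hν : ∀ a b, ν a * ν b ≤ ν (a ⊓ b) * ν (a ⊔ b))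
    (nE n0 n1 n2 n01 n02 n12 nT Z : ℝ) (hZ : ∑ t, ν t = Z)
    (hE : ν ![false, false, false] = nE) (h0 : ν ![true, false, false] = n0) (h1 : ν ![false, true,
        false] = n1) (h2 : ν ![false, false, true] = n2) (h01 : ν ![true, true, false] = n01) (h02 : ν ![true, false,
        true] = n02) (h12 : ν ![false, true, true] = n12) (hT : ν ![true, true, true] = nT) (r0 r01 r02 r12 rT : ℝ)
    (H :
      0 ≤ r0 ∧
      0 ≤ r01 ∧
      0 ≤ r02 ∧
      0 ≤ r12 ∧
      0 ≤ rT ∧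
      r0 ≤ Z * (Z + (nE + n1 + n2)) * n0 ∧
      r01 ≤ Z * (Z + (nE + n1 + n2)) * n01 ∧
      r02 ≤ Z * (Z + (nE + n1 + n2)) * n02 ∧
      r12 ≤ Z * (Z + (nE + n1 + n2)) * n12 ∧
      rT ≤ Z * (Z + (nE + n1 + n2)) * nT ∧
      Z * (n0 + n01 + n02 + n12 + nT) * n1 ≤ (Z * (Z + (nE + n1 + n2)) * n01 - r01) + (Z * (Z + (nE + n1 +
          n2)) * n12 - r12) + (Z * (Z + (nE + n1 + n2)) * nT - rT) ∧
      Z * (n0 + n01 + n02 + n12 + nT) * n2 ≤ (Z * (Z + (nE + n1 + n2)) * n02 - r02) + (Z * (Z + (nE + n1 +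
          n2)) * n12 - r12) + (Z * (Z + (nE + n1 + n2)) * nT - rT) ∧
      Z * (n0 + n01 + n02 + n12 + nT) * (n1 + n2) ≤ (Z * (Z + (nE + n1 + n2)) * n01 - r01) + (Z * (Z + (nE + n1 +
          n2)) * n02 - r02) + (Z * (Z + (nE + n1 + n2)) * n12 - r12) + (Z * (Z + (nE + n1 + n2)) * nT - rT) ∧
      r0 + r01 + r02 + r12 + rT = Z * Z * (n0 + n01 + n02 + n12 + nT) ∧
      Z * Z * nT ≤ rT ∧
      Z * Z * (n01 + nT) ≤ r01 + rT ∧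
      Z * Z * (n02 + nT) ≤ r02 + rT ∧
      Z * Z * (n12 + nT) ≤ r12 + rT ∧
      Z * Z * (n01 + n02 + nT) ≤ r01 + r02 + rT ∧
      Z * Z * (n0 + n01 + n02 + nT) ≤ r0 + r01 + r02 + rT ∧
      Z * Z * (n01 + n12 + nT) ≤ r01 + r12 + rT ∧
      Z * Z * (n02 + n12 + nT) ≤ r02 + r12 + rT ∧
      Z * Z * (n01 + n02 + n12 + nT) ≤ r01 + r02 + r12 + rT ∧
      Z * (nT * nT + nT * nT) - (n0 + n01 + n02 + n12 + nT) * nT * nT ≤ rT ∧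
      Z * (nT * (n01 + nT) + (n01 + nT) * nT) - (n0 + n01 + n02 + n12 + nT) * nT * (n01 + nT) ≤ rT ∧
      Z * (nT * (n02 + nT) + (n02 + nT) * nT) - (n0 + n01 + n02 + n12 + nT) * nT * (n02 + nT) ≤ rT ∧
      Z * (nT * (n12 + nT) + (n12 + nT) * nT) - (n0 + n01 + n02 + n12 + nT) * nT * (n12 + nT) ≤ rT ∧
      Z * (nT * (n01 + n02 + nT) + (n01 + n02 + nT) * nT) - (n0 + n01 + n02 + n12 + nT) * nT * (n01 + n02 + nT) ≤ rT ∧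
      Z * (nT * (n0 + n01 + n02 + nT) + (n0 + n01 + n02 + nT) * nT) - (n0 + n01 + n02 + n12 + nT) * nT * (n0 + n01 +
          n02 + nT) ≤ rT ∧
      Z * (nT * (n01 + n12 + nT) + (n1 + n01 + n12 + nT) * nT) - (n0 + n01 + n02 + n12 + nT) * nT * (n1 + n01 + n12 +
          nT) ≤ rT ∧
      Z * (nT * (n02 + n12 + nT) + (n2 + n02 + n12 + nT) * nT) - (n0 + n01 + n02 + n12 + nT) * nT * (n2 + n02 + n12 +
          nT) ≤ rT ∧
      Z * (nT * (n01 + n02 + n12 + nT) + (n1 + n2 + n01 + n02 + n12 + nT) * nT) - (n0 + n01 + n02 + n12 +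
          nT) * nT * (n1 + n2 + n01 + n02 + n12 + nT) ≤ rT ∧
      Z * ((n01 + nT) * (n01 + nT) + (n01 + nT) * (n01 + nT)) - (n0 + n01 + n02 + n12 + nT) * (n01 + nT) * (n01 +
          nT) ≤ r01 + rT ∧
      Z * ((n01 + nT) * (n02 + nT) + (n02 + nT) * (n01 + nT)) - (n0 + n01 + n02 + n12 + nT) * (n01 + nT) * (n02 +
          nT) ≤ rT ∧
      Z * ((n01 + nT) * (n12 + nT) + (n12 + nT) * (n01 + nT)) - (n0 + n01 + n02 + n12 + nT) * (n01 + nT) * (n12 +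
          nT) ≤ rT ∧
      Z * ((n01 + nT) * (n01 + n02 + nT) + (n01 + n02 + nT) * (n01 + nT)) - (n0 + n01 + n02 + n12 + nT) * (n01 +
          nT) * (n01 + n02 + nT) ≤ r01 + rT ∧
      Z * ((n01 + nT) * (n0 + n01 + n02 + nT) + (n0 + n01 + n02 + nT) * (n01 + nT)) - (n0 + n01 + n02 + n12 +
          nT) * (n01 + nT) * (n0 + n01 + n02 + nT) ≤ r01 + rT ∧
      Z * ((n01 + nT) * (n01 + n12 + nT) + (n1 + n01 + n12 + nT) * (n01 + nT)) - (n0 + n01 + n02 + n12 + nT) * (n01 +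
          nT) * (n1 + n01 + n12 + nT) ≤ r01 + rT ∧
      Z * ((n01 + nT) * (n02 + n12 + nT) + (n2 + n02 + n12 + nT) * (n01 + nT)) - (n0 + n01 + n02 + n12 + nT) * (n01 +
          nT) * (n2 + n02 + n12 + nT) ≤ rT ∧
      Z * ((n01 + nT) * (n01 + n02 + n12 + nT) + (n1 + n2 + n01 + n02 + n12 + nT) * (n01 + nT)) - (n0 + n01 + n02 +
          n12 + nT) * (n01 + nT) * (n1 + n2 + n01 + n02 + n12 + nT) ≤ r01 + rT ∧
      Z * ((n02 + nT) * (n02 + nT) + (n02 + nT) * (n02 + nT)) - (n0 + n01 + n02 + n12 + nT) * (n02 + nT) * (n02 +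
          nT) ≤ r02 + rT ∧
      Z * ((n02 + nT) * (n12 + nT) + (n12 + nT) * (n02 + nT)) - (n0 + n01 + n02 + n12 + nT) * (n02 + nT) * (n12 +
          nT) ≤ rT ∧
      Z * ((n02 + nT) * (n01 + n02 + nT) + (n01 + n02 + nT) * (n02 + nT)) - (n0 + n01 + n02 + n12 + nT) * (n02 +
          nT) * (n01 + n02 + nT) ≤ r02 + rT ∧
      Z * ((n02 + nT) * (n0 + n01 + n02 + nT) + (n0 + n01 + n02 + nT) * (n02 + nT)) - (n0 + n01 + n02 + n12 +
          nT) * (n02 + nT) * (n0 + n01 + n02 + nT) ≤ r02 + rT ∧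
      Z * ((n02 + nT) * (n01 + n12 + nT) + (n1 + n01 + n12 + nT) * (n02 + nT)) - (n0 + n01 + n02 + n12 + nT) * (n02 +
          nT) * (n1 + n01 + n12 + nT) ≤ rT ∧
      Z * ((n02 + nT) * (n02 + n12 + nT) + (n2 + n02 + n12 + nT) * (n02 + nT)) - (n0 + n01 + n02 + n12 + nT) * (n02 +
          nT) * (n2 + n02 + n12 + nT) ≤ r02 + rT ∧
      Z * ((n02 + nT) * (n01 + n02 + n12 + nT) + (n1 + n2 + n01 + n02 + n12 + nT) * (n02 + nT)) - (n0 + n01 + n02 +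
          n12 + nT) * (n02 + nT) * (n1 + n2 + n01 + n02 + n12 + nT) ≤ r02 + rT ∧
      Z * ((n12 + nT) * (n12 + nT) + (n12 + nT) * (n12 + nT)) - (n0 + n01 + n02 + n12 + nT) * (n12 + nT) * (n12 +
          nT) ≤ r12 + rT ∧
      Z * ((n12 + nT) * (n01 + n02 + nT) + (n01 + n02 + nT) * (n12 + nT)) - (n0 + n01 + n02 + n12 + nT) * (n12 +
          nT) * (n01 + n02 + nT) ≤ rT ∧
      Z * ((n12 + nT) * (n0 + n01 + n02 + nT) + (n0 + n01 + n02 + nT) * (n12 + nT)) - (n0 + n01 + n02 + n12 +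
          nT) * (n12 + nT) * (n0 + n01 + n02 + nT) ≤ rT ∧
      Z * ((n12 + nT) * (n01 + n12 + nT) + (n1 + n01 + n12 + nT) * (n12 + nT)) - (n0 + n01 + n02 + n12 + nT) * (n12 +
          nT) * (n1 + n01 + n12 + nT) ≤ r12 + rT ∧
      Z * ((n12 + nT) * (n02 + n12 + nT) + (n2 + n02 + n12 + nT) * (n12 + nT)) - (n0 + n01 + n02 + n12 + nT) * (n12 +
          nT) * (n2 + n02 + n12 + nT) ≤ r12 + rT ∧
      Z * ((n12 + nT) * (n01 + n02 + n12 + nT) + (n1 + n2 + n01 + n02 + n12 + nT) * (n12 + nT)) - (n0 + n01 + n02 +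
          n12 + nT) * (n12 + nT) * (n1 + n2 + n01 + n02 + n12 + nT) ≤ r12 + rT ∧
      Z * ((n01 + n02 + nT) * (n01 + n02 + nT) + (n01 + n02 + nT) * (n01 + n02 + nT)) - (n0 + n01 + n02 + n12 +
          nT) * (n01 + n02 + nT) * (n01 + n02 + nT) ≤ r01 + r02 + rT ∧
      Z * ((n01 + n02 + nT) * (n0 + n01 + n02 + nT) + (n0 + n01 + n02 + nT) * (n01 + n02 + nT)) - (n0 + n01 + n02 +
          n12 + nT) * (n01 + n02 + nT) * (n0 + n01 + n02 + nT) ≤ r01 + r02 + rT ∧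
      Z * ((n01 + n02 + nT) * (n01 + n12 + nT) + (n1 + n01 + n12 + nT) * (n01 + n02 + nT)) - (n0 + n01 + n02 + n12 +
          nT) * (n01 + n02 + nT) * (n1 + n01 + n12 + nT) ≤ r01 + rT ∧
      Z * ((n01 + n02 + nT) * (n02 + n12 + nT) + (n2 + n02 + n12 + nT) * (n01 + n02 + nT)) - (n0 + n01 + n02 + n12 +
          nT) * (n01 + n02 + nT) * (n2 + n02 + n12 + nT) ≤ r02 + rT ∧
      Z * ((n01 + n02 + nT) * (n01 + n02 + n12 + nT) + (n1 + n2 + n01 + n02 + n12 + nT) * (n01 + n02 + nT)) - (n0 +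
          n01 + n02 + n12 + nT) * (n01 + n02 + nT) * (n1 + n2 + n01 + n02 + n12 + nT) ≤ r01 + r02 + rT ∧
      Z * ((n0 + n01 + n02 + nT) * (n0 + n01 + n02 + nT) + (n0 + n01 + n02 + nT) * (n0 + n01 + n02 + nT)) - (n0 +
          n01 + n02 + n12 + nT) * (n0 + n01 + n02 + nT) * (n0 + n01 + n02 + nT) ≤ r0 + r01 + r02 + rT ∧
      Z * ((n0 + n01 + n02 + nT) * (n01 + n12 + nT) + (n1 + n01 + n12 + nT) * (n0 + n01 + n02 + nT)) - (n0 + n01 +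
          n02 + n12 + nT) * (n0 + n01 + n02 + nT) * (n1 + n01 + n12 + nT) ≤ r01 + rT ∧
      Z * ((n0 + n01 + n02 + nT) * (n02 + n12 + nT) + (n2 + n02 + n12 + nT) * (n0 + n01 + n02 + nT)) - (n0 + n01 +
          n02 + n12 + nT) * (n0 + n01 + n02 + nT) * (n2 + n02 + n12 + nT) ≤ r02 + rT ∧
      Z * ((n0 + n01 + n02 + nT) * (n01 + n02 + n12 + nT) + (n1 + n2 + n01 + n02 + n12 + nT) * (n0 + n01 + n02 +
          nT)) - (n0 + n01 + n02 + n12 + nT) * (n0 + n01 + n02 + nT) * (n1 + n2 + n01 + n02 + n12 + nT) ≤ r01 + r02 +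
          rT ∧
      Z * ((n1 + n01 + n12 + nT) * (n01 + n12 + nT) + (n1 + n01 + n12 + nT) * (n01 + n12 + nT)) - (n0 + n01 + n02 +
          n12 + nT) * (n1 + n01 + n12 + nT) * (n1 + n01 + n12 + nT) ≤ r01 + r12 + rT ∧
      Z * ((n1 + n01 + n12 + nT) * (n02 + n12 + nT) + (n2 + n02 + n12 + nT) * (n01 + n12 + nT)) - (n0 + n01 + n02 +
          n12 + nT) * (n1 + n01 + n12 + nT) * (n2 + n02 + n12 + nT) ≤ r12 + rT ∧
      Z * ((n1 + n01 + n12 + nT) * (n01 + n02 + n12 + nT) + (n1 + n2 + n01 + n02 + n12 + nT) * (n01 + n12 +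
          nT)) - (n0 + n01 + n02 + n12 + nT) * (n1 + n01 + n12 + nT) * (n1 + n2 + n01 + n02 + n12 + nT) ≤ r01 + r12 +
          rT ∧
      Z * ((n2 + n02 + n12 + nT) * (n02 + n12 + nT) + (n2 + n02 + n12 + nT) * (n02 + n12 + nT)) - (n0 + n01 + n02 +
          n12 + nT) * (n2 + n02 + n12 + nT) * (n2 + n02 + n12 + nT) ≤ r02 + r12 + rT ∧
      Z * ((n2 + n02 + n12 + nT) * (n01 + n02 + n12 + nT) + (n1 + n2 + n01 + n02 + n12 + nT) * (n02 + n12 +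
          nT)) - (n0 + n01 + n02 + n12 + nT) * (n2 + n02 + n12 + nT) * (n1 + n2 + n01 + n02 + n12 + nT) ≤ r02 + r12 +
          rT ∧
      Z * ((n1 + n2 + n01 + n02 + n12 + nT) * (n01 + n02 + n12 + nT) + (n1 + n2 + n01 + n02 + n12 + nT) * (n01 +
          n02 + n12 + nT)) - (n0 + n01 + n02 + n12 + nT) * (n1 + n2 + n01 + n02 + n12 + nT) * (n1 + n2 + n01 + n02 +
          n12 + nT) ≤ r01 + r02 + r12 + rT) :
    ∃ (R : (Fin 3 → Bool) → ℝ) (Fl : (Fin 3 → Bool) → (Fin 3 → Bool) → ℝ),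
      (∀ t ∈ M, 0 ≤ R t) ∧ (∀ t s, 0 ≤ Fl t s) ∧ (∀ t s, Fl t s ≠ 0 → s ≤ t) ∧
      (∀ t ∈ M, R t + ∑ s ∈ Mᶜ, Fl t s ≤ (∑ r, ν r) * ((∑ r, ν r) + ∑ r ∈ Mᶜ, ν r) * ν t) ∧
      (∀ s ∈ Mᶜ, (∑ r, ν r) * (∑ r ∈ M, ν r) * ν s ≤ ∑ t ∈ M, Fl t s) ∧
      (∀ S S' : Finset (Fin 3 → Bool), IsUpperSet (S : Set (Fin 3 → Bool)) → IsUpperSet (S' : Set (Fin 3 → Bool)) →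
        (∑ r, ν r) * ((∑ t ∈ S, ν t) * (∑ t ∈ S' ∩ M, ν t) + (∑ t ∈ S', ν t) * (∑ t ∈ S ∩ M, ν t))
            - (∑ r ∈ M, ν r) * (∑ t ∈ S, ν t) * (∑ t ∈ S', ν t)
          ≤ ∑ t ∈ (S ∩ S') ∩ M, R t
            + ∑ s ∈ (S ∩ S') ∩ Mᶜ, (∑ t ∈ M, Fl t s - (∑ r, ν r) * (∑ r ∈ M, ν r) * ν s)) := by
  subst hM
  have H' := H
  obtain ⟨h_r_nonneg_0, h_r_nonneg_01, h_r_nonneg_02, h_r_nonneg_12, h_r_nonneg_T, h_cap_0, h_cap_01, h_cap_02,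
      h_cap_12, h_cap_T, h_hall_1, h_hall_2, h_hall_12, h_total, -, -, -, -, -, -, -, -, -, -, -, -, -, -, -, -, -,
      -, -, -, -, -, -, -, -, -, -, -, -, -, -, -, -, -, -, -, -, -, -, -, -, -, -, -, -, -, -, -, -, -, -, -, -,
      -⟩ := H'
  have nn : 0 ≤ nE ∧ 0 ≤ n0 ∧ 0 ≤ n1 ∧ 0 ≤ n2 ∧ 0 ≤ n01 ∧ 0 ≤ n02 ∧ 0 ≤ n12 ∧ 0 ≤ nT := by
    refine ⟨?_, ?_, ?_, ?_, ?_, ?_, ?_, ?_⟩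
    · rw [← hE]; exact hν0 _
    · rw [← h0]; exact hν0 _
    · rw [← h1]; exact hν0 _
    · rw [← h2]; exact hν0 _
    · rw [← h01]; exact hν0 _
    · rw [← h02]; exact hν0 _
    · rw [← h12]; exact hν0 _
    · rw [← hT]; exact hν0 _
  obtain ⟨nnE, nn0, nn1, nn2, nn01, nn02, nn12, nnT⟩ := nn
  have mem5 : ∀ {t : Fin 3 → Bool}, t ∈ ({![true, false, false], ![true, true, false], ![true, false, true], ![false,
      true, true], ![true, true, true]} : Finset (Fin 3 → Bool)) → t = ![true, false, false] ∨ t = ![true, true,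
      false] ∨ t = ![true, false, true] ∨ t = ![false, true, true] ∨ t = ![true, true, true] := by
    intro t h
    simpa only [Finset.mem_insert, Finset.mem_singleton] using h
  have hUc : ({![true, false, false], ![true, true, false], ![true, false, true], ![false, true, true], ![true, true,
      true]} : Finset (Fin 3 → Bool))ᶜ = ({![false, false, false], ![false, true, false], ![false, false,
      true]} : Finset (Fin 3 → Bool)) := by decide
  have hND : ∑ r ∈ ({![true, false, false], ![true, true, false], ![true, false, true], ![false, true, true], ![true,
      true, true]} : Finset (Fin 3 → Bool))ᶜ, ν r = (nE + n1 + n2) := by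
    rw [hUc, Finset.sum_insert (by simp), Finset.sum_insert (by simp), Finset.sum_singleton, hE, h1, h2]
    ring
  have hNU : ∑ r ∈ ({![true, false, false], ![true, true, false], ![true, false, true], ![false, true, true], ![true,
      true, true]} : Finset (Fin 3 → Bool)), ν r = (n0 + n01 + n02 + n12 + nT) := by
    rw [Finset.sum_insert (by simp), Finset.sum_insert (by simp), Finset.sum_insert (by simp),
        Finset.sum_insert (by simp),
      Finset.sum_singleton, h0, h01, h02, h12, hT]
    ring
  -- the retained masses
  set R : (Fin 3 → Bool) → ℝ := fun t => if t = ![true, false, false] then r0 else if t = ![true, true,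
      false] then r01 else if t = ![true, false, true] then r02 else if t = ![false, true,
      true] then r12 else if t = ![true, true, true] then rT else 0 with hRdef
  have hR0 : R ![true, false, false] = r0 := by simp [hRdef]
  have hR01 : R ![true, true, false] = r01 := by simp [hRdef]
  have hR02 : R ![true, false, true] = r02 := by simp [hRdef]
  have hR12 : R ![false, true, true] = r12 := by simp [hRdef]
  have hRT : R ![true, true, true] = rT := by simp [hRdef]
  -- the flows: Strassen with slack for demands `Z u ν` on `OPᶜ` and capacities `Z(Z+d)ν − R` on `OP`
  set dem : (Fin 3 → Bool) → ℝ := fun s => if s ∈ ({![true, false, false], ![true, true, false], ![true, false,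
      true], ![false, true, true], ![true, true,
      true]} : Finset (Fin 3 → Bool)) then (0 : ℝ) else Z * (n0 + n01 + n02 + n12 + nT) * ν s
    with hdem
  set cap : (Fin 3 → Bool) → ℝ := fun t => if t ∈ ({![true, false, false], ![true, true, false], ![true, false,
      true], ![false, true, true], ![true, true,
      true]} : Finset (Fin 3 → Bool)) then Z * (Z + (nE + n1 + n2)) * ν t - R t else 0
    with hcap
  have hU0 : 0 ≤ (n0 + n01 + n02 + n12 + nT) := by linarith
  have hZ0 : 0 ≤ Z := hZ ▸ Finset.sum_nonneg fun t _ => hν0 t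
  have dem0 : ∀ s, 0 ≤ dem s := fun s => by
    simp only [hdem]
    split_ifs
    · exact le_rfl
    · exact mul_nonneg (mul_nonneg hZ0 hU0) (hν0 s)
  have vc : cap ![true, false, false] = Z * (Z + (nE + n1 + n2)) * n0 - r0 ∧
      cap ![true, true, false] = Z * (Z + (nE + n1 + n2)) * n01 - r01 ∧
      cap ![true, false, true] = Z * (Z + (nE + n1 + n2)) * n02 - r02 ∧
      cap ![false, true, true] = Z * (Z + (nE + n1 + n2)) * n12 - r12 ∧
      cap ![true, true, true] = Z * (Z + (nE + n1 + n2)) * nT - rT := by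
    simp [hcap, hRdef, h0, h01, h02, h12, hT]
  obtain ⟨k0, k01, k02, k12, kT⟩ := vc
  have cap0 : ∀ t, 0 ≤ cap t := fun t => by
    by_cases ht : t ∈ ({![true, false, false], ![true, true, false], ![true, false, true], ![false, true, true],
        ![true, true, true]} : Finset (Fin 3 → Bool))
    · rcases mem5 ht with rfl | rfl | rfl | rfl | rfl
      · rw [k0]; linarith
      · rw [k01]; linarith
      · rw [k02]; linarith
      · rw [k12]; linarith
      · rw [kT]; linarith
    · simp only [hcap, if_neg ht]; exact le_rfl
  have capc : ∀ t, t ∉ ({![true, false, false], ![true, true, false], ![true, false, true], ![false, true, true],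
      ![true, true, true]} : Finset (Fin 3 → Bool)) → cap t = 0 := fun t ht => by simp only [hcap, if_neg ht]
  have vd : dem ![false, false, false] = Z * (n0 + n01 + n02 + n12 + nT) * nE ∧
      dem ![false, true, false] = Z * (n0 + n01 + n02 + n12 + nT) * n1 ∧
      dem ![false, false, true] = Z * (n0 + n01 + n02 + n12 + nT) * n2 ∧ dem ![true, false, false] = 0 ∧
      dem ![true, true, false] = 0 ∧ dem ![true, false, true] = 0 ∧ dem ![false, true, true] = 0 ∧
      dem ![true, true, true] = 0 := by
    simp [hdem, hE, h1, h2]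
  obtain ⟨dE, d1, d2, d0, d01, d02, d12, dT⟩ := vd
  have demv : ∀ s, s ∉ ({![true, false, false], ![true, true, false], ![true, false, true], ![false, true, true],
      ![true, true, true]} : Finset (Fin 3 → Bool)) → dem s = Z * (n0 + n01 + n02 + n12 + nT) * ν s := fun s hs => by
    simp only [hdem, if_neg hs]
  have hdom := dominance dem cap cap0 nE n0 n1 n2 n01 n02 n12 nT Z r0 r01 r02 r12 rT hZ0 nnE nn0 nn1 nn2 nn01 nn02
      nn12 nnT
    dE d1 d2 d0 d01 d02 d12 dT k0 k01 k02 k12 kT h_hall_1 h_hall_2 h_hall_12 h_total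
  obtain ⟨π, hπ0, hsupp, hπ1, hπ2⟩ :=
    Literature.Probability.LatticeModels.exists_subcoupling_of_upperSets_le dem cap dem0 cap0 hdom
  -- no flow ends outside `OP`
  have hπc : ∀ s t, t ∉ ({![true, false, false], ![true, true, false], ![true, false, true], ![false, true, true],
      ![true, true, true]} : Finset (Fin 3 → Bool)) → π s t = 0 := fun s t ht => by
    have h := hπ2 t
    rw [capc t ht] at h
    have hz := (Finset.sum_eq_zero_iff_of_nonneg fun y _ => hπ0 y t).1
      (le_antisymm h (Finset.sum_nonneg fun y _ => hπ0 y t))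
    exact hz s (Finset.mem_univ s)
  have hKeq : ∀ s ∈ ({![true, false, false], ![true, true, false], ![true, false, true], ![false, true, true],
      ![true, true, true]} : Finset (Fin 3 → Bool))ᶜ, ∑ t ∈ ({![true, false, false], ![true, true, false], ![true,
      false, true], ![false, true, true], ![true, true, true]} : Finset (Fin 3 → Bool)), π s t = (∑ r,
      ν r) * (∑ r ∈ ({![true, false, false], ![true, true, false], ![true, false, true], ![false, true, true],
      ![true, true, true]} : Finset (Fin 3 → Bool)), ν r) * ν s := by
    intro s hs
    rw [hZ, hNU, ← demv s (Finset.mem_compl.1 hs), ← hπ1 s]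
    exact Finset.sum_subset (Finset.subset_univ _) fun t _ ht => hπc s t ht
  refine ⟨R, fun t s => π s t, fun t ht => ?_, fun t s => hπ0 s t, fun t s h => hsupp s t h, fun t ht => ?_,
    fun s hs => (hKeq s hs).symm.le, ?_⟩
  · rcases mem5 ht with rfl | rfl | rfl | rfl | rfl
    · rw [hR0]; exact h_r_nonneg_0
    · rw [hR01]; exact h_r_nonneg_01
    · rw [hR02]; exact h_r_nonneg_02
    · rw [hR12]; exact h_r_nonneg_12
    · rw [hRT]; exact h_r_nonneg_T
  · have h := hπ2 t
    have hv : cap t = Z * (Z + (nE + n1 + n2)) * ν t - R t := by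
      simp only [hcap, if_pos ht]
    rw [hv] at h
    have hsub : ∑ s ∈ ({![true, false, false], ![true, true, false], ![true, false, true], ![false, true, true],
        ![true, true, true]} : Finset (Fin 3 → Bool))ᶜ, π s t ≤ ∑ s, π s t :=
      Finset.sum_le_univ_sum_of_nonneg fun s => hπ0 s t
    rw [hZ, hND]
    linarith
  · exact pair_all _ rfl ν hν0 hν nE n0 n1 n2 n01 n02 n12 nT Z hZ h0 h1 h2 h01 h02 h12 hT r0 r01 r02 r12 rT R hR0
      hR01 hR02 hR12 hRT
      (fun t s => π s t) hKeq H

end Summit.CriticalPhenomena.PercolationContinuityZ3.Theorems.SahiE3OrPairPattern
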